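import Summits.AtomisticToContinuum.BoseEinsteinCondensation.Theorems.BECProbeMassFlowCloudMomentumAtomFreeKyFanGapLocallyBounded
import Summits.AtomisticToContinuum.BoseEinsteinCondensation.Theorems.BECConjugateDominationHardCoreExtensionLemmaGBridge
import Literature.Barriers.AtomisticToContinuum.KineticGapLengthScalesThermodynamicWindow
import HarnessLib

/-!
# Crux `BoundaryTransferWeak` (stmt-AtomisticToContinuum-0827), line `rim-squeeze-monotone-coherence`:
# stub (G) `stub_torusGap` on the HARD-CORE class, conditionally on Lemma G

The registered stub (G) (torus Ky Fan gap `2E₀ < kyFanTwo` below some density, eventually in `N`) is LANDED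
for the locally bounded class (`stub_torusGap_locallyBounded`, p155109). On the HARD-CORE class (`v = ⊤` on
`[0,a)`, bounded on every `(a', ∞)`, `a' > a`) it follows from Lemma G of crux `HardCoreExtension`
(stmt-AtomisticToContinuum-11786: `S_N`-transitive connectedness of the dilute torus hard-sphere free region,
eventually in `N`; registered there as `stub_lemmaGConnected`; open in print, Baryshnikov–Bubenik–Kahle 2014 §6)
through the landed chain `lemmaGBridge_c3` → `kyFanGap_hardCore_of_transitive`, Ruelle finiteness
(`exists_eventually_periodicGroundStateEnergy_lt_top`) and `L' → ∞`. This file records that conditional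
implication (skeleton v2's residual `stub_torusGap_singular` = this hard-core class modulo Lemma G + the
essential exotic `⊤`-class, residue `stub_essExoticTruncationGap` of stmt-11786).
-/

noncomputable section

namespace Summit.AtomisticToContinuum.BoseEinsteinCondensation.RimSqueeze

open Literature.MathematicalPhysics.QuantumManyBody.BoseGas MeasureTheory Filter Set
open scoped ENNReal NNReal ComplexConjugate

/-- **Stub (G) on the HARD-CORE class, conditionally on Lemma G** (helper of the registered residual
`stub_torusGap_singular` of line `rim-squeeze-monotone-coherence`, crux stmt-AtomisticToContinuum-0827): if the
dilute torus hard-sphere free region is `S_N`-transitively connected eventually in `N` at small density (Lemma G of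
crux `HardCoreExtension`, stmt-AtomisticToContinuum-11786, in the expanded form consumed by `lemmaGBridge_c3`),
then for every admissible `v` with `v = ⊤` on `[0,a)` and bounded on every `(a',∞)`, `a' > a`, the torus Ky Fan gap
`2E₀ < kyFanTwo` holds below some density, eventually in `N` (`lemmaGBridge_c3` → `kyFanGap_hardCore_of_transitive`
+ Ruelle finiteness + `L' → ∞`). [folklore] -/
theorem stub_torusGap_hardCore_of_lemmaG : (∀ b : ℝ, 0 < b → ∃ ρ₁ : ℝ, 0 < ρ₁ ∧ ∀ ρ : ℝ, 0 < ρ → ρ < ρ₁ → ∀ᶠ N : ℕ in Filter.atTop, ∀ X ∈ {X : Config N | ∀ i j : Fin N, i ≠ j → ∀ n : Fin 3 → ℤ, b < ‖X i - X j - latticeVec (sideLength ρ N) n‖}, ∀ Y ∈ {X : Config N | ∀ i j : Fin N, i ≠ j → ∀ n : Fin 3 → ℤ, b < ‖X i - X j - latticeVec (sideLength ρ N) n‖}, ∃ σ : Equiv.Perm (Fin N), JoinedIn {X : Config N | ∀ i j : Fin N, i ≠ j → ∀ n : Fin 3 → ℤ, b < ‖X i - X j - latticeVec (sideLength ρ N)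 n‖} X (Y ∘ σ)) → ∀ v : ℝ → ℝ≥0∞, IsRepulsiveFiniteRange v → ∀ a : ℝ, 0 < a → (∀ r : ℝ, 0 ≤ r → r < a → v r = ⊤) → (∀ a' : ℝ, a < a' → ∃ M : ℝ≥0∞, M ≠ ⊤ ∧ ∀ r : ℝ, a' < r → v r ≤ M) → ∃ ρ₁ : ℝ, 0 < ρ₁ ∧ ∀ ρ' : ℝ, 0 < ρ' → ρ' < ρ₁ → ∀ᶠ N : ℕ in atTop, 2 * periodicGroundStateEnergy v N (sideLength ρ' N) < kyFanTwo v N (sideLength ρ' N) := by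
  intro hG v hv a ha hcore htail
  obtain ⟨ρR, hρR, hfin⟩ :=
    Literature.Barriers.AtomisticToContinuum.BoseGas.exists_eventually_periodicGroundStateEnergy_lt_top hv
  obtain ⟨ρG, hρG, htransAll⟩ :=
    Cruxes.HardCoreExtension.ThirdLawCurrentFloorAlt.lemmaGBridge_c3 hG a ha
  refine ⟨min ρR ρG, lt_min hρR hρG, fun ρ' hρ' hρ'₁ => ?_⟩
  obtain ⟨R₀, hR₀⟩ := hv.2
  filter_upwards [hfin ρ' hρ' (hρ'₁.trans_le (min_le_left _ _)),
    htransAll ρ' hρ' (hρ'₁.trans_le (min_le_right _ _)),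
    (tendsto_sideLength_atTop hρ').eventually_gt_atTop 0,
    (tendsto_sideLength_atTop hρ').eventually_gt_atTop (2 * R₀)] with N hE htrans hL h2R
  exact Cruxes.CloudMomentumAtom.Birth.kyFanGap_hardCore_of_transitive v hv a ha hcore htail R₀ hR₀ N _
    hL h2R hE.ne htrans

end Summit.AtomisticToContinuum.BoseEinsteinCondensation.RimSqueeze

end
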